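import Summits.Schanuel.Schanuel.Theorems.ZilberEacDegenerateDirectionRows
import HarnessLib

/-!
# The exponential-polynomial regime, CX (b): THE PERTURBATION `G(x, e^{x₁}; y₀) − G(x, 0; y₀)`
# IN THE DEGENERATE SECTOR — holomorphy and super-exponential smallness

HONEST FRAMING.  Cell `pub-schanuel` (Zilber's Exponential-Algebraic Closedness, case ladder;
host summit Schanuel), seat 2, gen 34.  Infrastructure for file CX (c).  Along the place
`x₀ = σ^{-ek}`, `x₁ = Φ(σ^e)σ^{-eM}` and in the sector `σ = ζ^{-1}tu` (`ζ^e = z`, `t → 0⁺`,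
`u → 1`) with `Re(Φ(0) z^M) < 0`, the multiplicative coordinate `y₁ = e^{x₁}` satisfies
`|y₁| ≤ exp(−c t^{-eM})`, so the normalised perturbation
`P(σ, Y) = σ^{-ν}(G(x, e^{x₁}; σ^L Y) − G(x, 0; σ^L Y))` of the degenerate fibre relation is
holomorphic for small `σ ≠ 0` (**`degeneratePerturbation_differentiableAt`**) and tends to `0` in
the sector uniformly for `Y` bounded (**`degeneratePerturbation_small`**: every power of `t^{-1}`
is beaten by `exp(−c t^{-eM})`).  [folklore analysis]; nothing here bears on Mantova–Masser's
question (OPEN), EC(3,2) (OPEN) or Schanuel's conjecture (neither used nor implied); EAC ⇏ SC.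
-/

noncomputable section

open Filter Topology Metric Complex Polynomial

set_option linter.dupNamespace false

namespace Summit.Schanuel.Schanuel.Theorems

/-! ## Part A. Holomorphy of the perturbation -/

/-- **The perturbation is jointly holomorphic** in `(σ, Y)` for small `σ ≠ 0`. [folklore] -/
theorem degeneratePerturbation_differentiableAt {Φ : ℂ → ℂ} {ρ : ℝ}
    (hΦd : ∀ w : ℂ, ‖w‖ < ρ → DifferentiableAt ℂ Φ w) (e k M : ℕ) (he : 1 ≤ e)
    (G : Polynomial (MvPolynomial (Fin 3) ℂ)) (ν L : ℤ) {σ : ℂ} (hσ0 : σ ≠ 0) (hσ1 : ‖σ‖ < 1)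
    (hσρ : ‖σ‖ < ρ) (Y : ℂ) :
    DifferentiableAt ℂ (fun p : ℂ × ℂ => (p.1 ^ ν)⁻¹ *
      ((G.map (MvPolynomial.eval ![((p.1 ^ e) ^ k)⁻¹, Φ (p.1 ^ e) * ((p.1 ^ e) ^ M)⁻¹,
          Complex.exp (Φ (p.1 ^ e) * ((p.1 ^ e) ^ M)⁻¹)])).eval (p.1 ^ L * p.2) -
       (G.map (MvPolynomial.eval ![((p.1 ^ e) ^ k)⁻¹, Φ (p.1 ^ e) * ((p.1 ^ e) ^ M)⁻¹, 0])).eval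
          (p.1 ^ L * p.2))) (σ, Y) := by
  have hσe : ‖σ ^ e‖ < ρ := by
    rw [norm_pow]
    exact (pow_le_of_le_one (norm_nonneg _) hσ1.le (by omega)).trans_lt hσρ
  have d1 : DifferentiableAt ℂ (fun p : ℂ × ℂ => p.1) (σ, Y) := differentiableAt_fst
  have dpe : DifferentiableAt ℂ (fun p : ℂ × ℂ => p.1 ^ e) (σ, Y) := d1.pow e
  have hpe0 : ((σ ^ e) ^ k) ≠ 0 := pow_ne_zero _ (pow_ne_zero _ hσ0)
  have hpM0 : ((σ ^ e) ^ M) ≠ 0 := pow_ne_zero _ (pow_ne_zero _ hσ0)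
  have dx₀ : DifferentiableAt ℂ (fun p : ℂ × ℂ => ((p.1 ^ e) ^ k)⁻¹) (σ, Y) :=
    (dpe.pow k).inv hpe0
  have dΦ : DifferentiableAt ℂ (fun p : ℂ × ℂ => Φ (p.1 ^ e)) (σ, Y) :=
    (hΦd _ hσe).comp (σ, Y) dpe
  have dx₁ : DifferentiableAt ℂ (fun p : ℂ × ℂ => Φ (p.1 ^ e) * ((p.1 ^ e) ^ M)⁻¹) (σ, Y) :=
    dΦ.mul ((dpe.pow M).inv hpM0)
  have dy₁ : DifferentiableAt ℂ
      (fun p : ℂ × ℂ => Complex.exp (Φ (p.1 ^ e) * ((p.1 ^ e) ^ M)⁻¹)) (σ, Y) := dx₁.cexp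
  have dY : DifferentiableAt ℂ (fun p : ℂ × ℂ => p.1 ^ L * p.2) (σ, Y) :=
    (d1.zpow (Or.inl hσ0)).mul differentiableAt_snd
  have dν : DifferentiableAt ℂ (fun p : ℂ × ℂ => (p.1 ^ ν)⁻¹) (σ, Y) :=
    (d1.zpow (Or.inl hσ0)).inv (zpow_ne_zero _ hσ0)
  have d0 : DifferentiableAt ℂ (fun _ : ℂ × ℂ => (0 : ℂ)) (σ, Y) := differentiableAt_const _
  have dGf := differentiableAt_polyMap_eval₃ G dx₀ dx₁ dy₁ dY
  have dGd := differentiableAt_polyMap_eval₃ G dx₀ dx₁ d0 dY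
  exact dν.mul (dGf.sub dGd)

/-! ## Part B. Super-exponential smallness of the perturbation in the sector -/

/-- `‖σ‖^L ≤ (‖σ‖⁻¹)^{|L|}` for `0 < ‖σ‖ ≤ 1`. [folklore] -/
theorem zpow_le_inv_pow_natAbs {r : ℝ} (hr0 : 0 < r) (hr1 : r ≤ 1) (L : ℤ) :
    r ^ L ≤ r⁻¹ ^ L.natAbs := by
  have hri : 1 ≤ r⁻¹ := (one_le_inv₀ hr0).2 hr1
  rcases le_or_gt 0 L with hL | hL
  · obtain ⟨n, rfl⟩ := Int.eq_ofNat_of_zero_le hL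
    rw [zpow_natCast, Int.natAbs_natCast]
    exact (pow_le_one₀ hr0.le hr1).trans (one_le_pow₀ hri)
  · have h1 : r⁻¹ ^ L.natAbs = r ^ L := by
      rw [← Int.natAbs_neg, ← zpow_natCast r⁻¹, Int.natAbs_of_nonneg (by omega : 0 ≤ -L),
        inv_zpow', neg_neg]
    rw [h1]

/-- **Norms in the sector** `σ = ζ^{-1}tu`, `‖u − 1‖ < 1/2`: `(‖ζ⁻¹‖/2) t ≤ ‖σ‖ ≤ 2‖ζ⁻¹‖ t`.
[folklore] -/
theorem sector_norm_bounds {ζ : ℂ} {t : ℝ} (ht : 0 < t) {u σ : ℂ} (hσ : σ = ζ⁻¹ * t * u)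
    (hu : ‖u - 1‖ < 1 / 2) : ‖ζ⁻¹‖ / 2 * t ≤ ‖σ‖ ∧ ‖σ‖ ≤ 2 * ‖ζ⁻¹‖ * t := by
  have hul : 1 / 2 ≤ ‖u‖ := by
    have := norm_sub_norm_le (1 : ℂ) u
    rw [norm_one, norm_sub_rev] at this
    linarith
  have huu : ‖u‖ ≤ 2 := by
    have := norm_le_norm_add_norm_sub' u 1
    rw [norm_one] at this
    linarith
  have hr : ‖σ‖ = ‖ζ⁻¹‖ * t * ‖u‖ := by
    rw [hσ, norm_mul, norm_mul, Complex.norm_real, Real.norm_of_nonneg ht.le]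
  have h0 : 0 ≤ ‖ζ⁻¹‖ * t := by positivity
  refine ⟨?_, ?_⟩
  · rw [hr]
    have := mul_le_mul_of_nonneg_left hul h0
    linarith
  · rw [hr]
    have := mul_le_mul_of_nonneg_left huu h0
    linarith

/-- **The direction in the sector.**  If `Re(Φ(σ^e) z^M u^{-eM}) ≤ −c` for `‖σ‖ < δ₁`,
`‖u − 1‖ < η₁`, then along `σ = ζ^{-1}tu` (`ζ^e = z`): `Re(Φ(σ^e)(σ^e)^{-M}) ≤ −c t^{-eM}`.
[folklore] -/
theorem sector_re_le {Φ : ℂ → ℂ} {e M : ℕ} {ζ z : ℂ} (hζ : ζ ^ e = z) {c δ₁ η₁ : ℝ}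
    (hdirc : ∀ σ u : ℂ, ‖σ‖ < δ₁ → ‖u - 1‖ < η₁ →
      (Φ (σ ^ e) * z ^ M * (u ^ (e * M))⁻¹).re ≤ -c)
    {t : ℝ} (ht : 0 < t) {u σ : ℂ} (hσ : σ = ζ⁻¹ * t * u) (hσδ : ‖σ‖ < δ₁) (hu : ‖u - 1‖ < η₁) :
    (Φ (σ ^ e) * ((σ ^ e) ^ M)⁻¹).re ≤ -c * t⁻¹ ^ (e * M) := by
  have hid : ((σ ^ e) ^ M)⁻¹ = z ^ M * (u ^ (e * M))⁻¹ * (((t⁻¹ ^ (e * M) : ℝ)) : ℂ) := by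
    rw [hσ, ← pow_mul, mul_pow, mul_pow, mul_inv, mul_inv, inv_pow, inv_inv, pow_mul, hζ]
    push_cast
    ring
  rw [hid, show Φ (σ ^ e) * (z ^ M * (u ^ (e * M))⁻¹ * (((t⁻¹ ^ (e * M) : ℝ)) : ℂ)) =
    (((t⁻¹ ^ (e * M) : ℝ)) : ℂ) * (Φ (σ ^ e) * z ^ M * (u ^ (e * M))⁻¹) by ring,
    Complex.re_ofReal_mul]
  have h1 := hdirc σ u hσδ hu
  have h2 : 0 < t⁻¹ ^ (e * M) := by positivity
  have h3 := mul_le_mul_of_nonneg_left h1 h2.le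
  linarith

/-- **The perturbation is super-exponentially small in the sector.**  With `ζ^e = z`,
`Re(Φ(0) z^M) < 0` (`M ≥ 1`) and `σ = ζ^{-1}tu`: for every `R, ε > 0` there are `δ, η > 0` such
that `0 < t < δ`, `‖u − 1‖ < η`, `‖Y‖ ≤ R` imply
`‖σ^{-ν}(G(x(σ), e^{x₁(σ)}; σ^L Y) − G(x(σ), 0; σ^L Y))‖ < ε` (stated for a variable `σ` with
`σ = ζ^{-1}tu`, to keep the terms small). [folklore analysis] (new) -/
theorem degeneratePerturbation_small {Φ : ℂ → ℂ} (hΦc : ContinuousAt Φ 0) {e k M : ℕ}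
    (he : 1 ≤ e) (hM : 1 ≤ M) {ζ z : ℂ} (hζ : ζ ^ e = z) (hz0 : z ≠ 0)
    (hdir : (Φ 0 * z ^ M).re < 0) (G : Polynomial (MvPolynomial (Fin 3) ℂ)) (ν L : ℤ) :
    ∀ R > 0, ∀ ε > 0, ∃ δ > 0, ∃ η > 0, ∀ (t : ℝ) (u Y σ : ℂ), 0 < t → t < δ → ‖u - 1‖ < η →
      ‖Y‖ ≤ R → σ = ζ⁻¹ * t * u →
      ‖(σ ^ ν)⁻¹ *
        ((G.map (MvPolynomial.eval ![((σ ^ e) ^ k)⁻¹, Φ (σ ^ e) * ((σ ^ e) ^ M)⁻¹,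
            Complex.exp (Φ (σ ^ e) * ((σ ^ e) ^ M)⁻¹)])).eval (σ ^ L * Y) -
         (G.map (MvPolynomial.eval ![((σ ^ e) ^ k)⁻¹, Φ (σ ^ e) * ((σ ^ e) ^ M)⁻¹, 0])).eval
            (σ ^ L * Y))‖ < ε := by
  intro R hR ε hε
  -- constants
  have hζ0 : ζ ≠ 0 := by
    rintro rfl
    rw [zero_pow (by omega)] at hζ
    exact hz0 hζ.symm
  have hzi : 0 < ‖ζ⁻¹‖ := norm_pos_iff.2 (inv_ne_zero hζ0)
  obtain ⟨C₁, hC₁, N₁, hbound⟩ := exists_norm_polyMap_sub_le G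
  have he0 : (0 : ℂ) ^ e = 0 := zero_pow (by omega)
  have hΦc' : ContinuousAt (fun σ : ℂ => Φ (σ ^ e)) 0 :=
    hΦc.comp_of_eq (continuous_pow e).continuousAt (by simp [he0])
  have hdir' : ((fun σ : ℂ => Φ (σ ^ e)) 0 * z ^ M).re < 0 := by
    simp only [he0]
    exact hdir
  obtain ⟨c, hc, δ₁, hδ₁, η₁, hη₁, hdirc⟩ := exists_direction_const hΦc' (z ^ M) (e * M) hdir'
  obtain ⟨δ₂, hδ₂, hΦb⟩ : ∃ δ₂ > 0, ∀ w : ℂ, ‖w‖ < δ₂ → ‖Φ w‖ ≤ ‖Φ 0‖ + 1 := by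
    obtain ⟨δ, hδ, h⟩ := (Metric.continuousAt_iff.1 hΦc) 1 one_pos
    refine ⟨δ, hδ, fun w hw => ?_⟩
    have h1 := h (x := w) (by rwa [dist_zero_right])
    rw [dist_eq_norm] at h1
    have := norm_le_norm_add_norm_sub' (Φ w) (Φ 0)
    linarith
  set a : ℝ := ‖ζ⁻¹‖ / 2 with ha
  have ha0 : 0 < a := by positivity
  set D₀ : ℕ := e * k + e * M + L.natAbs with hD₀
  set Ntot : ℕ := D₀ * N₁ + ν.natAbs with hNtot
  set K : ℝ := C₁ * (‖Φ 0‖ + 1 + R) ^ N₁ * a⁻¹ ^ Ntot with hK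
  have hK0 : 0 < K := by positivity
  have heM : 1 ≤ e * M := Nat.one_le_iff_ne_zero.2 (Nat.mul_ne_zero (by omega) (by omega))
  -- super-smallness: `t⁻¹^Ntot exp(-c t⁻¹^{eM}) < ε / K` for small `t > 0`
  obtain ⟨δ₃, hδ₃, hsmall⟩ : ∃ δ₃ > 0, ∀ t : ℝ, 0 < t → t < δ₃ →
      t⁻¹ ^ Ntot * Real.exp (-(c * t⁻¹ ^ (e * M))) < ε / K := by
    have hlim := tendsto_zpow_neg_mul_exp_neg hc heM Ntot
    have hev := (tendsto_order.1 hlim).2 (ε / K) (by positivity)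
    rw [eventually_nhdsWithin_iff, Metric.eventually_nhds_iff] at hev
    obtain ⟨δ, hδ, h⟩ := hev
    refine ⟨δ, hδ, fun t ht htδ => ?_⟩
    have h1 := h (y := t) (by rwa [dist_zero_right, Real.norm_eq_abs, abs_of_pos ht]) ht
    rwa [zpow_neg, zpow_natCast, zpow_neg, zpow_natCast, ← inv_pow, ← inv_pow] at h1
  -- the tolerances
  set Dm : ℝ := min (min δ₁ δ₂) 1 with hDm
  have hDm0 : 0 < Dm := lt_min (lt_min hδ₁ hδ₂) one_pos
  set δ : ℝ := min δ₃ (Dm / (2 * ‖ζ⁻¹‖ + 1)) with hδ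
  have hδ0 : 0 < δ := lt_min hδ₃ (by positivity)
  refine ⟨δ, hδ0, min η₁ (1 / 2), lt_min hη₁ (by norm_num), fun t u Y σ ht htδ hu hY hσ => ?_⟩
  -- `u` and `r = ‖σ‖`
  have hu2 : ‖u - 1‖ < 1 / 2 := hu.trans_le (min_le_right _ _)
  obtain ⟨hra', hrb⟩ := sector_norm_bounds ht hσ hu2
  have hra : a * t ≤ ‖σ‖ := by rw [ha]; exact hra'
  have hr0 : 0 < ‖σ‖ := lt_of_lt_of_le (by positivity) hra
  have hσ0 : σ ≠ 0 := norm_pos_iff.1 hr0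
  have hrD : ‖σ‖ < Dm := by
    have htD : t < Dm / (2 * ‖ζ⁻¹‖ + 1) := htδ.trans_le (min_le_right _ _)
    calc ‖σ‖ ≤ 2 * ‖ζ⁻¹‖ * t := hrb
      _ = ‖ζ⁻¹‖ * t * 2 := by ring
      _ < ‖ζ⁻¹‖ * (Dm / (2 * ‖ζ⁻¹‖ + 1)) * 2 := by
          have : ‖ζ⁻¹‖ * t < ‖ζ⁻¹‖ * (Dm / (2 * ‖ζ⁻¹‖ + 1)) := mul_lt_mul_of_pos_left htD hzi
          linarith
      _ = Dm * (2 * ‖ζ⁻¹‖ / (2 * ‖ζ⁻¹‖ + 1)) := by ring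
      _ ≤ Dm * 1 := by
          refine mul_le_mul_of_nonneg_left ?_ hDm0.le
          rw [div_le_one (by positivity)]
          linarith
      _ = Dm := mul_one _
  have hr1 : ‖σ‖ < 1 := hrD.trans_le (min_le_right _ _)
  have hrδ₁ : ‖σ‖ < δ₁ := hrD.trans_le ((min_le_left _ _).trans (min_le_left _ _))
  have hrδ₂ : ‖σ‖ < δ₂ := hrD.trans_le ((min_le_left _ _).trans (min_le_right _ _))
  have hσe : ‖σ ^ e‖ ≤ ‖σ‖ := by
    rw [norm_pow]
    exact pow_le_of_le_one (norm_nonneg _) hr1.le (by omega)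
  -- the bound `X`
  set ri : ℝ := ‖σ‖⁻¹ with hri
  have hri1 : 1 ≤ ri := (one_le_inv₀ hr0).2 hr1.le
  have hri0 : 0 < ri := by positivity
  have hripow : ∀ n : ℕ, n ≤ D₀ → ri ^ n ≤ ri ^ D₀ := fun n hn => pow_le_pow_right₀ hri1 hn
  set X : ℝ := (‖Φ 0‖ + 1 + R) * ri ^ D₀ with hX
  have hB1 : 1 ≤ ‖Φ 0‖ + 1 + R := by linarith [norm_nonneg (Φ 0)]
  have hriD : 1 ≤ ri ^ D₀ := one_le_pow₀ hri1
  have hX1 : 1 ≤ X := by rw [hX]; nlinarith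
  have hXri : ri ^ D₀ ≤ X := by rw [hX]; nlinarith
  have hx0 : ‖((σ ^ e) ^ k)⁻¹‖ ≤ X := by
    rw [norm_inv, norm_pow, norm_pow, ← pow_mul, ← inv_pow]
    exact (hripow _ (by rw [hD₀]; omega)).trans hXri
  have hΦσ : ‖Φ (σ ^ e)‖ ≤ ‖Φ 0‖ + 1 := hΦb _ (hσe.trans_lt hrδ₂)
  have hx1 : ‖Φ (σ ^ e) * ((σ ^ e) ^ M)⁻¹‖ ≤ X := by
    rw [norm_mul, norm_inv, norm_pow, norm_pow, ← pow_mul, ← inv_pow, hX]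
    refine mul_le_mul (by linarith) (hripow _ (by rw [hD₀]; omega)) (by positivity)
      (by positivity)
  have hYL : ‖σ ^ L * Y‖ ≤ X := by
    rw [norm_mul, norm_zpow, hX, mul_comm]
    refine mul_le_mul (by linarith [norm_nonneg (Φ 0)]) ((zpow_le_inv_pow_natAbs hr0 hr1.le L).trans
      (hripow _ (by rw [hD₀]; omega))) (by positivity) (by positivity)
  -- the direction: `Re x₁ ≤ -c t⁻¹^{eM}`
  have hx1re : (Φ (σ ^ e) * ((σ ^ e) ^ M)⁻¹).re ≤ -c * t⁻¹ ^ (e * M) :=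
    sector_re_le hζ hdirc ht hσ hrδ₁ (hu.trans_le (min_le_left _ _))
  have hy1e : ‖Complex.exp (Φ (σ ^ e) * ((σ ^ e) ^ M)⁻¹)‖ ≤ Real.exp (-(c * t⁻¹ ^ (e * M))) := by
    rw [Complex.norm_exp]
    exact Real.exp_le_exp.2 (by linarith)
  have hy1 : ‖Complex.exp (Φ (σ ^ e) * ((σ ^ e) ^ M)⁻¹)‖ ≤ 1 :=
    hy1e.trans (Real.exp_le_one_iff.2 (by
      have : 0 < c * t⁻¹ ^ (e * M) := by positivity
      linarith))
  -- the polynomial bound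
  have hB := hbound ![((σ ^ e) ^ k)⁻¹, Φ (σ ^ e) * ((σ ^ e) ^ M)⁻¹,
      Complex.exp (Φ (σ ^ e) * ((σ ^ e) ^ M)⁻¹)]
    ![((σ ^ e) ^ k)⁻¹, Φ (σ ^ e) * ((σ ^ e) ^ M)⁻¹, 0] X (σ ^ L * Y)
    (by simp) (by simp) (by simp) hX1 (by simpa using hx0) (by simpa using hx1)
    (by simpa using hy1) hYL
  have hv2 : ‖(![((σ ^ e) ^ k)⁻¹, Φ (σ ^ e) * ((σ ^ e) ^ M)⁻¹,
      Complex.exp (Φ (σ ^ e) * ((σ ^ e) ^ M)⁻¹)] : Fin 3 → ℂ) 2‖ ≤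
      Real.exp (-(c * t⁻¹ ^ (e * M))) := by simpa using hy1e
  -- `‖(σ^ν)⁻¹‖ ≤ ri^{|ν|}`, `X^{N₁}`, `ri ≤ (a t)⁻¹`
  have hνb : ‖(σ ^ ν)⁻¹‖ ≤ ri ^ ν.natAbs := by
    rw [norm_inv, norm_zpow, ← zpow_neg]
    have := zpow_le_inv_pow_natAbs hr0 hr1.le (-ν)
    rwa [Int.natAbs_neg] at this
  have hXN : X ^ N₁ = (‖Φ 0‖ + 1 + R) ^ N₁ * ri ^ (D₀ * N₁) := by
    rw [hX, mul_pow, ← pow_mul]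
  have hria : ri ≤ (a * t)⁻¹ := by
    rw [hri]
    exact inv_anti₀ (by positivity) hra
  have hriN : ri ^ Ntot ≤ a⁻¹ ^ Ntot * t⁻¹ ^ Ntot := by
    rw [← mul_pow, ← mul_inv]
    exact pow_le_pow_left₀ hri0.le hria _
  -- assemble
  have hexp0 : 0 ≤ Real.exp (-(c * t⁻¹ ^ (e * M))) := (Real.exp_pos _).le
  calc ‖(σ ^ ν)⁻¹ * ((G.map (MvPolynomial.eval ![((σ ^ e) ^ k)⁻¹,
            Φ (σ ^ e) * ((σ ^ e) ^ M)⁻¹, Complex.exp (Φ (σ ^ e) * ((σ ^ e) ^ M)⁻¹)])).eval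
            (σ ^ L * Y) -
         (G.map (MvPolynomial.eval ![((σ ^ e) ^ k)⁻¹, Φ (σ ^ e) * ((σ ^ e) ^ M)⁻¹, 0])).eval
            (σ ^ L * Y))‖
      ≤ ri ^ ν.natAbs * (C₁ * Real.exp (-(c * t⁻¹ ^ (e * M))) * X ^ N₁) := by
        rw [norm_mul]
        refine mul_le_mul hνb (hB.trans ?_) (norm_nonneg _) (by positivity)
        exact mul_le_mul_of_nonneg_right (mul_le_mul_of_nonneg_left hv2 hC₁.le) (by positivity)
    _ = C₁ * (‖Φ 0‖ + 1 + R) ^ N₁ * (ri ^ Ntot * Real.exp (-(c * t⁻¹ ^ (e * M)))) := by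
        rw [hXN, hNtot, pow_add]
        ring
    _ ≤ C₁ * (‖Φ 0‖ + 1 + R) ^ N₁ *
          (a⁻¹ ^ Ntot * t⁻¹ ^ Ntot * Real.exp (-(c * t⁻¹ ^ (e * M)))) := by
        refine mul_le_mul_of_nonneg_left (mul_le_mul_of_nonneg_right hriN hexp0) (by positivity)
    _ = K * (t⁻¹ ^ Ntot * Real.exp (-(c * t⁻¹ ^ (e * M)))) := by rw [hK]; ring
    _ < K * (ε / K) := mul_lt_mul_of_pos_left (hsmall t ht (htδ.trans_le (min_le_left _ _))) hK0
    _ = ε := by field_simp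

end Summit.Schanuel.Schanuel.Theorems

end
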